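import Literature.IUT.HodgeArakelov.PlusMinusTowerStableCurveBridge
import Literature.IUT.HodgeArakelov.LabelClassesOfCuspsCor24iProofs2

/-!
# [IUTchII] Cor 2.4 (i) for Π_v-cuspidal inertia groups through the tower↔[IUTchI] §2 agreement (proofs, part 3)

S. Mochizuki, *Inter-universal Teichmüller theory II*, kurims manuscript (Dec. 2020), §2, Corollary 2.4 (i) pp. 69–71 and
Remark 2.4.1 p. 71 ([IUTchII] Cor 2.4 (i), Rmk 2.4.1, kurims pp.69-71) [claim: Mochizuki2012, status: disputed] (D-0012 claim key;
series status DISPUTED).  PROOF-ONLY companion (abc-iut cell, seat abc-iut-w4-d012; node `IUTchII:Cor2.4(i)`) of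
abc-iut-L6-t7's bridge `PlusMinusTowerStableCurveBridge.lean` (MERGE-MAP B13, p412701: `PlusMinusTower.StableCurveAgreement`)
and of parts 1–2 (`LabelClassesOfCuspsCor24iProofs{,2}.lean`, p411807 / p412700).  No new definitions.

WHY A PART 3.  B13's `StableCurveAgreement.h25` feeds hypothesis (A) of `cor24_i_of_inputs` for `Π^±_v`-CUSPIDAL inertia
groups (`C.IsCuspidalInertia W.piPM I`, via [IUTchI] Cor. 2.5), whereas Cor. 2.4 (i) — and the decl of record `Cor24_i'` —
concern a cuspidal inertia group `I_t ⊆ Π_v` OF `Π_v` (`C.IsCuspidalInertia W.piV I`), which is the index-`l` subgroup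
`I'^l = I' ∩ Π_v` of the `Π^±_v`-cuspidal group `I'` above it (Rmk. 2.3.1; `X̲̲_v → X_v` is totally ramified at the cusps).
Print handles exactly this in Remark 2.4.1: "by applying [IUTchI], Proposition 2.4, (i) [cf. the proof of [IUTchI],
Corollary 2.5; [IUTchI], Remark 2.5.2], one may replace `I_t` in Corollary 2.4 by its maximal pro-`l′` subgroup".  So here
input (A) is derived from abc-iut-L5-t1's `StableCurveTemperedData.Prop24i` ([IUTchI] Prop. 2.4 (i): "for `Λ ⊆ Δ^tp_X` a
nontrivial pro-`Σ` compact subgroup and `γ ∈ Π̂_X` with `γ·Λ·γ⁻¹ ⊆ Δ^tp_X`, we have `γ ∈ Π^tp_X`") for ANY subgroup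
`I ⊆ Δ̂^±_v` containing (the image of) such a `Λ` — a HYPOTHESIS `hΛ` ("`I_t` contains a nontrivial compact pro-`Σ`
subgroup of `Δ^tp_{X_v}`", true at the model for `Σ ∌ p_v`: `I_t ≅ Ẑ(1)`), never asserted:

* `StableCurveAgreement.inputA_of_prop24i` — agreement + `D.Prop24i` + `hΛ` ⊢ hypothesis (A) (`h25`) of
  `cor24_i_of_inputs`, for `I ⊆ Δ̂^cor_v`-kernel; PROVED;
* `cor24_i'_of_agreement` — the decl of record `Cor24_i'` from: the agreement, `D.Prop24i`, `hΛ`, and for each admissible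
  `Π_{v□}` (`Cor24_family`) an `ℍ`-dictionary with `D.Cor23ii`, `D.Cor23v` (B13's `h23v`) and the open-subgroup step (B)
  (`h23vi`, GAP-LEDGER G-w4d012-2 — the ONE remaining non-L5-node hypothesis).  PROVED.

Nothing here takes a side on [IUTchIII] Cor. 3.12; typed ≠ discharged (the L5 predicates `Prop24i`, `Cor23ii`, `Cor23v` and
the agreement are hypotheses).
-/

namespace Literature.IUT.HodgeArakelov

namespace PlusMinusTower

namespace StableCurveAgreement

open Literature.IUT.HodgeTheaters Literature.AnabelianGeometry.SemiGraphs

universe u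

variable {S : BadPlaceSetting.{u}} {P : TopGroup.{u}} {T : TemperedCoverings S P}
  {W : PlusMinusTower T} {C : CuspidalInertiaData W} {D : StableCurveTemperedData.{u}}

/-- **IUTchII:Rmk2.4.1** (kurims p. 71) / **IUTchI:Prop2.4(i)** (kurims p. 50) transported = hypothesis (A) of
`cor24_i_of_inputs` for an arbitrary subgroup `I ⊆ Δ̂^cor_v` that contains (through `eHat`) a nontrivial compact pro-`Σ`
subgroup `Λ ⊆ Δ^tp_{X_v}` (e.g. the maximal pro-`l′` subgroup of a `Π_v`-cuspidal inertia group `I_t`, Rmk. 2.4.1): for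
`γ' ∈ Δ̂^±_v`, "`I^{γ'} ⊆ Π^±_v` implies `γ' ∈ Δ^±_v`" — since then `γ'·Λ·γ'⁻¹ ⊆ Π^±_v ∩ Δ̂^±_v = Δ^±_v = Δ^tp_{X_v}` and
Prop. 2.4 (i) gives `γ' ∈ Π^tp_{X_v} = Π^±_v`.  `D.Prop24i` and `hΛ` are HYPOTHESES.  PROVED.
[claim: Mochizuki2012, status: disputed] (IUTchII §2 Rmk 2.4.1, kurims p.71) -/
theorem inputA_of_prop24i (A : StableCurveAgreement W C D) (h24i : D.Prop24i) {I : Subgroup W.Corhat}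
    (hIker : I ≤ W.aug.ker)
    (hΛ : ∃ Λ : Subgroup D.DeltaTp, IsCompact (Λ : Set D.DeltaTp) ∧ Λ ≠ ⊥ ∧ IsProSigma D.graph.Sigma Λ ∧
      (Λ.map D.DeltaTp.subtype).map D.ιX ≤ (I.subgroupOf W.pmHat).map A.eHat.toMonoidHom) :
    ∀ γ' : W.Corhat, γ' ∈ W.pmHat ⊓ W.aug.ker →
      I.map (MulAut.conj γ').toMonoidHom ≤ W.piPM → γ' ∈ W.piPM := by
  intro γ' hγ' hc
  obtain ⟨Λ, hcpt, hne, hSig, hΛI⟩ := hΛ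
  have hγ'pm : γ' ∈ W.pmHat := (Subgroup.mem_inf.mp hγ').1
  set g : D.PiHat := A.eHat ⟨γ', hγ'pm⟩ with hg
  -- Prop 2.4 (i): it suffices that `g · ιX(λ) · g⁻¹ ∈ Im(Δ^tp_X)` for all `λ ∈ Λ`
  have key : ∀ l ∈ Λ, g * D.ιX l * g⁻¹ ∈ D.DeltaTp.map D.ιX := by
    intro l hl
    -- `ιX l = eHat q` for some `q ∈ I ∩ Π̂^±_v`
    have hlI : D.ιX (l : D.PiTp) ∈ (I.subgroupOf W.pmHat).map A.eHat.toMonoidHom :=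
      hΛI ⟨(l : D.PiTp), ⟨l, hl, rfl⟩, rfl⟩
    obtain ⟨q, hqI, hql⟩ := hlI
    rw [MulEquiv.coe_toMonoidHom] at hql
    have hqI' : (q : W.Corhat) ∈ I := Subgroup.mem_subgroupOf.mp hqI
    -- the conjugate `γ' q γ'⁻¹` lies in `I^{γ'} ⊆ Π^±_v` and in `Δ̂^cor_v = Ker(aug)`
    have hconj_mem : γ' * (q : W.Corhat) * γ'⁻¹ ∈ I.map (MulAut.conj γ').toMonoidHom := by
      rw [Subgroup.mem_map_equiv, MulAut.conj_symm_apply]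
      have e : γ'⁻¹ * (γ' * (q : W.Corhat) * γ'⁻¹) * γ' = q := by group
      rwa [e]
    have hconj_pm : γ' * (q : W.Corhat) * γ'⁻¹ ∈ W.piPM := hc hconj_mem
    have hconj_ker : γ' * (q : W.Corhat) * γ'⁻¹ ∈ W.aug.ker :=
      W.aug.ker.mul_mem (W.aug.ker.mul_mem (Subgroup.mem_inf.mp hγ').2 (hIker hqI'))
        (W.aug.ker.inv_mem (Subgroup.mem_inf.mp hγ').2)
    have hconj_hat : γ' * (q : W.Corhat) * γ'⁻¹ ∈ W.pmHat :=
      W.pmHat.mul_mem (W.pmHat.mul_mem hγ'pm q.2) (W.pmHat.inv_mem hγ'pm)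
    -- transport along `eHat`
    have hX : A.eHat ⟨_, hconj_hat⟩ ∈ D.ιX.range := (A.mem_piPM_iff ⟨_, hconj_hat⟩).mp hconj_pm
    have hΔ : A.eHat ⟨_, hconj_hat⟩ ∈ D.DeltaHat := (A.mem_ker_iff ⟨_, hconj_hat⟩).mp hconj_ker
    have heq : A.eHat ⟨_, hconj_hat⟩ = g * D.ιX l * g⁻¹ := by
      have : (⟨γ' * (q : W.Corhat) * γ'⁻¹, hconj_hat⟩ : W.pmHat) = ⟨γ', hγ'pm⟩ * q * ⟨γ', hγ'pm⟩⁻¹ := rfl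
      rw [this, map_mul, map_mul, map_inv, hql, hg]
    rw [← heq]
    obtain ⟨p, hp⟩ := hX
    have hpΔ : p ∈ D.DeltaTp := by
      rw [MonoidHom.mem_ker, ← D.prHat_comp, MonoidHom.comp_apply, hp]
      exact hΔ
    exact ⟨p, hpΔ, hp⟩
  have hgX : g ∈ D.ιX.range := h24i.mem_of_conj_le Λ hcpt hne hSig g key
  exact (A.mem_piPM_iff ⟨γ', hγ'pm⟩).mpr hgX

end StableCurveAgreement

end PlusMinusTower

/-! ### Assembly: `Cor24_i'` from the agreement, [IUTchI] Prop 2.4 (i), Cor 2.3 (ii)(v), and the open-subgroup step (B) -/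

section Assembly

open Literature.IUT.HodgeTheaters Literature.AnabelianGeometry.SemiGraphs

universe u

variable {S : BadPlaceSetting.{u}} {P : TopGroup.{u}} {T : TemperedCoverings S P}
  {D : EtaleThetaData S.toThetaSetting P} {Dsc : StableCurveTemperedData.{u}}
  (Dec : SubgraphDecomposition S T D) (W : PlusMinusTower T) (C : CuspidalInertiaData W)
  {L : LabCuspStructure C} (Ld : LabelledDecomposition Dec L) (I : Subgroup W.Corhat)

/-- **IUTchII:Cor2.4(i)′ from the tower↔[IUTchI] §2 agreement.**  For a subgroup `I ⊆ Δ̂^cor_v` containing (through the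
agreement) a nontrivial compact pro-`Σ` subgroup of `Δ^tp_{X_v}` (`hΛ`; Rmk. 2.4.1), the decl of record `Cor24_i'` follows
from: abc-iut-L6-t7's agreement `A` (B13), abc-iut-L5-t1's [IUTchI] Prop. 2.4 (i) (`Dsc.Prop24i`), and, for each admissible
`Π_{v□}` (`Cor24_family`), an `ℍ`-dictionary with [IUTchI] Cor. 2.3 (ii), (v) (`Dsc.Cor23ii`, `Dsc.Cor23v`; B13's `h23v`) plus
the open-subgroup step (B) of the printed proof (`h23vi`, GAP-LEDGER G-w4d012-2) — all HYPOTHESES, never asserted.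
PROVED (assembly of `cor24_i'_of_inputs`, `inputA_of_prop24i`, `StableCurveAgreement.h23v`).
[claim: Mochizuki2012, status: disputed] (IUTchII §2 Cor 2.4 (i), kurims pp.69-71) -/
theorem cor24_i'_of_agreement (A : W.StableCurveAgreement C Dsc) (h24i : Dsc.Prop24i) (h23ii : Dsc.Cor23ii)
    (h23vD : Dsc.Cor23v) (hIker : I ≤ W.aug.ker)
    (hΛ : ∃ Λ : Subgroup Dsc.DeltaTp, IsCompact (Λ : Set Dsc.DeltaTp) ∧ Λ ≠ ⊥ ∧ IsProSigma Dsc.graph.Sigma Λ ∧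
      (Λ.map Dsc.DeltaTp.subtype).map Dsc.ιX ≤ (I.subgroupOf W.pmHat).map A.eHat.toMonoidHom)
    (Dic : ∀ H : Subgroup P, Cor24_family Dec Ld H → A.SubgraphDictionary H)
    (h23vi : ∀ H : Subgroup P, Cor24_family Dec Ld H →
      ∀ γ' : W.Corhat, γ' ∈ W.piPM ⊓ W.aug.ker →
        I.map (MulAut.conj γ').toMonoidHom ≤ W.pmBox H → γ' ∈ closure (W.deltaPmBox H : Set W.Corhat)) :
    Literature.IUT.HodgeArakelov.Cor24_i' Dec W C Ld I :=
  cor24_i'_of_inputs Dec W C Ld I (A.inputA_of_prop24i h24i hIker hΛ)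
    fun H hH => ⟨h23vi H hH, A.h23v (Dic H hH) h23ii h23vD⟩

end Assembly

end Literature.IUT.HodgeArakelov
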